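import Mathlib
import HarnessLib
import Summits.NavierStokesRegularity.NavierStokesRegularity.Theorems.LocalSineTubeDoorLocalPointZoomUniform
import Summits.NavierStokesRegularity.NavierStokesRegularity.Theorems.IsobarTomographyTubeAlternativeStubDefectAnalyticOfVelocity

/-!
# Route `LocalSineTubeDoor`, zoom item `LocalPointZoom` (stmt-NavierStokesRegularity-20017) — support: DIAGONAL
# convergence of the rescaled velocities and gradients at the slice `s = −1`

Cell ns-regularity-ideate, seat p6 (route-directed support, `--supports stmt-NavierStokesRegularity-20017`).  Corollary of
the locally uniform space–time convergence `…LocalPointZoomUniform.localZoomFrame_uniform` (U0)/(U1) and of the joint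
real-analyticity of the profile (`…Ancient.analyticOnNhd_uncurry`, `…AnalyticPropagation.analyticOnNhd_uncurry_fderiv_slice`):

* `localZoomFrame_diag` — in the local zoom frame, for ANY sequences `sⱼ → −1`, `yⱼ → y`:
  `Zⱼ(sⱼ, yⱼ) → v₁(−1, y)` and `D Zⱼ(sⱼ, ·)(yⱼ) → D v₁(−1, ·)(y)`.

PURPOSE: doors whose profile crux needs the window property on ONE slice only (the sine door: `eq_zero_of_aligned_window`)
can be fed by window data along ANY sequence of times comparable to the zoom scales — the slice parameter then varies
with `j` and converges along a subsequence, which is exactly the diagonal situation (cf. the cell's FlexibleZoom /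
most-times doors for ScaledTopAlignment).

WHAT THIS IS NOT: not a claim about Navier–Stokes regularity; a compactness lemma for door routes (bears_on LADDER-NS N0).
-/

noncomputable section

-- the summit and its single sub-problem share the name (CONVENTIONS §1), as in every Theorems file
set_option linter.dupNamespace false

namespace Summit.NavierStokesRegularity.NavierStokesRegularity.Theorems.LocalSineTubeDoorLocalPointZoomDiag

open MeasureTheory Set Function Filter Topology TopologicalSpace Metric
open Literature.Analysis Literature.Analysis.FluidPDE Literature.Analysis.FluidPDE.SereginSverak2009
open Summit.NavierStokesRegularity.NavierStokesRegularity.Theorems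
open Summit.NavierStokesRegularity.NavierStokesRegularity.Theorems.LocalSineTubeDoorProfileAlignedWindowRigidityAncient
open Summit.NavierStokesRegularity.NavierStokesRegularity.Theorems.LocalSineTubeDoorLocalPointZoomUpgrade
open Summit.NavierStokesRegularity.NavierStokesRegularity.Theorems.LocalSineTubeDoorLocalPointZoomData
open Summit.NavierStokesRegularity.NavierStokesRegularity.Theorems.LocalSineTubeDoorLocalPointZoomUniform
open Summit.NavierStokesRegularity.NavierStokesRegularity.Theorems.TubeAlternative.AnalyticPropagation
open scoped NNReal ENNReal

/-- **Diagonal zoom convergence at the slice `s = −1`**: in the local zoom frame, for any sequences `sⱼ → −1` and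
`yⱼ → y`, the rescaled velocities `Zⱼ(sⱼ, yⱼ)` converge to `v₁(−1, y)` and the rescaled gradients `D Zⱼ(sⱼ,·)(yⱼ)` to
`D v₁(−1,·)(y)` ((U0)/(U1) of `localZoomFrame_uniform` + joint continuity of `v₁`, `∇v₁`). -/
theorem localZoomFrame_diag {ν T : ℝ} (hν : 0 < ν) (hT : 0 < T) {u : ℝ → (EuclideanSpace ℝ (Fin 3)) → (EuclideanSpace ℝ (Fin 3))}
    (hcont : ContinuousOn (uncurry u) (Ico 0 T ×ˢ univ)) {x₀ : (EuclideanSpace ℝ (Fin 3))} {ρ M : ℝ} (hρ : 0 < ρ)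
    (hM : ∀ t ∈ Ico 0 T, T - ρ ^ 2 < t → ∀ x ∈ ball x₀ ρ, ‖u t x‖ * Real.sqrt (ν * (T - t)) ≤ M)
    {R : ℝ} (hR : 0 < R) {v' : ℝ → (EuclideanSpace ℝ (Fin 3)) → (EuclideanSpace ℝ (Fin 3))} {π' : ℝ → (EuclideanSpace ℝ (Fin 3)) → ℝ}
    (hball1 : IsSuitableWeakSolutionInBall 1 0 v' π') {lam : ℕ → ℝ} (hlam : ∀ j, 0 < lam j)
    (hlam0 : Tendsto lam atTop (𝓝 0)) {Ks : ℝ≥0} {r₁ : ℝ} (hr₁ : 0 < r₁) (hr₁1 : r₁ ≤ 1)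
    (hKs : ∀ r ∈ Ioc (0 : ℝ) r₁, cknD r (0 : ℝ × (EuclideanSpace ℝ (Fin 3))) π' ≤ Ks)
    (hpt : ∀ (j : ℕ) (s : ℝ) (y : (EuclideanSpace ℝ (Fin 3))), ((lam j) • stPull ((lam j) ^ 2) (lam j) (0 : ℝ) (0 : (EuclideanSpace ℝ (Fin 3))) v') s y =
      ((R * (lam j / 2)) / ν) • u (T + (R * (lam j / 2)) ^ 2 * s / ν) (x₀ + (R * (lam j / 2)) • y))
    {w v₁ : ℝ → (EuclideanSpace ℝ (Fin 3)) → (EuclideanSpace ℝ (Fin 3))}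
    (hL3 : ∀ a : ℝ, 0 < a → Tendsto (fun j => eLpNorm (uncurry ((lam j) • stPull ((lam j) ^ 2) (lam j) (0 : ℝ) (0 : (EuclideanSpace ℝ (Fin 3))) v') - uncurry w) 3
      (volume.restrict (parabolicCylinder a (0 : ℝ × (EuclideanSpace ℝ (Fin 3)))))) atTop (𝓝 0))
    (hae : ∀ᵐ x ∂(volume.restrict (Iio (0 : ℝ) ×ˢ (univ : Set (EuclideanSpace ℝ (Fin 3))))), uncurry w x = uncurry v₁ x)
    {C₁ : ℝ} (hv₁rate : HasTypeITimeDecay C₁ v₁) (hv₁cont : ContinuousOn (uncurry v₁) (Iio (0 : ℝ) ×ˢ univ))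
    (hv₁mild : ∀ s t : ℝ, s < t → t < 0 → ∀ x,
      v₁ t x = UnboundedOperators.heatExtension (v₁ s) (t - s) x - oseenDuhamel 1 s v₁ v₁ t x)
    (y : (EuclideanSpace ℝ (Fin 3))) {sseq : ℕ → ℝ} {yseq : ℕ → EuclideanSpace ℝ (Fin 3)}
    (hs : Tendsto sseq atTop (𝓝 (-1))) (hy : Tendsto yseq atTop (𝓝 y)) :
    Tendsto (fun j => ((lam j) • stPull ((lam j) ^ 2) (lam j) (0 : ℝ) (0 : (EuclideanSpace ℝ (Fin 3))) v') (sseq j) (yseq j))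
      atTop (𝓝 (v₁ (-1) y)) ∧
    Tendsto (fun j => fderiv ℝ (((lam j) • stPull ((lam j) ^ 2) (lam j) (0 : ℝ) (0 : (EuclideanSpace ℝ (Fin 3))) v') (sseq j)) (yseq j))
      atTop (𝓝 (fderiv ℝ (v₁ (-1)) y)) := by
  obtain ⟨hU0, hU1, -⟩ := localZoomFrame_uniform hν hT hcont hρ hM hR hball1 hlam hlam0 hr₁ hr₁1 hKs hpt hL3 hae
    hv₁rate hv₁cont hv₁mild y
  -- the pair `(sⱼ, yⱼ) → (−1, y)` in space–time
  have hpair : Tendsto (fun j => ((sseq j, yseq j) : ℝ × EuclideanSpace ℝ (Fin 3))) atTop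
      (𝓝 (((-1 : ℝ), y) : ℝ × EuclideanSpace ℝ (Fin 3))) := hs.prodMk_nhds hy
  have hmem : (((-1 : ℝ), y) : ℝ × EuclideanSpace ℝ (Fin 3)) ∈ Iio (0 : ℝ) ×ˢ (univ : Set (EuclideanSpace ℝ (Fin 3))) :=
    mk_mem_prod (by norm_num) (mem_univ _)
  have hslab_nhds : Iio (0 : ℝ) ×ˢ (univ : Set (EuclideanSpace ℝ (Fin 3))) ∈ 𝓝 (((-1 : ℝ), y) : ℝ × EuclideanSpace ℝ (Fin 3)) :=
    (isOpen_Iio.prod isOpen_univ).mem_nhds hmem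
  -- joint continuity of the profile and of its spatial gradient on the open slab
  have hv₁an : AnalyticOnNhd ℝ (uncurry v₁) (Iio (0 : ℝ) ×ˢ univ) :=
    analyticOnNhd_uncurry hv₁cont (bdd_of_hasTypeITimeDecay hv₁rate) hv₁mild
  have hc0 : Tendsto (fun j => v₁ (sseq j) (yseq j)) atTop (𝓝 (v₁ (-1) y)) := by
    exact (hv₁an _ hmem).continuousAt.tendsto.comp hpair
  have hc1 : Tendsto (fun j => fderiv ℝ (v₁ (sseq j)) (yseq j)) atTop (𝓝 (fderiv ℝ (v₁ (-1)) y)) := by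
    exact ((analyticOnNhd_uncurry_fderiv_slice hv₁an isOpen_Iio) _ hmem).continuousAt.tendsto.comp hpair
  -- eventually the pair lies in the balls of (U0)/(U1)
  have hin8 : ∀ᶠ j in atTop, ((sseq j, yseq j) : ℝ × EuclideanSpace ℝ (Fin 3)) ∈
      ball (((-1 : ℝ), y) : ℝ × EuclideanSpace ℝ (Fin 3)) (1 / 8) :=
    hpair (ball_mem_nhds _ (by norm_num))
  have hin16 : ∀ᶠ j in atTop, ((sseq j, yseq j) : ℝ × EuclideanSpace ℝ (Fin 3)) ∈
      ball (((-1 : ℝ), y) : ℝ × EuclideanSpace ℝ (Fin 3)) (1 / 16) :=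
    hpair (ball_mem_nhds _ (by norm_num))
  refine ⟨?_, ?_⟩
  · -- ## level zero
    refine Metric.tendsto_nhds.2 fun ε hε => ?_
    have h1 := hU0 (ε / 2) (half_pos hε)
    have h2 := Metric.tendsto_nhds.1 hc0 (ε / 2) (half_pos hε)
    filter_upwards [h1, h2, hin8] with j hj1 hj2 hj8
    calc dist (((lam j) • stPull ((lam j) ^ 2) (lam j) (0 : ℝ) (0 : (EuclideanSpace ℝ (Fin 3))) v') (sseq j) (yseq j))
          (v₁ (-1) y)
        ≤ dist (((lam j) • stPull ((lam j) ^ 2) (lam j) (0 : ℝ) (0 : (EuclideanSpace ℝ (Fin 3))) v') (sseq j) (yseq j))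
            (v₁ (sseq j) (yseq j)) + dist (v₁ (sseq j) (yseq j)) (v₁ (-1) y) := dist_triangle _ _ _
      _ < ε / 2 + ε / 2 := by
          refine add_lt_add ?_ hj2
          rw [dist_eq_norm]
          exact hj1 (sseq j, yseq j) hj8
      _ = ε := by ring
  · -- ## level one
    refine Metric.tendsto_nhds.2 fun ε hε => ?_
    have h1 := hU1 (ε / 2) (half_pos hε)
    have h2 := Metric.tendsto_nhds.1 hc1 (ε / 2) (half_pos hε)
    filter_upwards [h1, h2, hin16] with j hj1 hj2 hj16
    calc dist (fderiv ℝ (((lam j) • stPull ((lam j) ^ 2) (lam j) (0 : ℝ) (0 : (EuclideanSpace ℝ (Fin 3))) v') (sseq j)) (yseq j))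
          (fderiv ℝ (v₁ (-1)) y)
        ≤ dist (fderiv ℝ (((lam j) • stPull ((lam j) ^ 2) (lam j) (0 : ℝ) (0 : (EuclideanSpace ℝ (Fin 3))) v') (sseq j)) (yseq j))
            (fderiv ℝ (v₁ (sseq j)) (yseq j)) + dist (fderiv ℝ (v₁ (sseq j)) (yseq j)) (fderiv ℝ (v₁ (-1)) y) :=
          dist_triangle _ _ _
      _ < ε / 2 + ε / 2 := by
          refine add_lt_add ?_ hj2
          rw [dist_eq_norm]
          exact hj1 (sseq j, yseq j) hj16
      _ = ε := by ring

end Summit.NavierStokesRegularity.NavierStokesRegularity.Theorems.LocalSineTubeDoorLocalPointZoomDiag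

end
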